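import Mathlib
import Summits.KontsevichZagierPeriods.Zeta5Search.UniversalDigit
import HarnessLib

/-!
# ζ(5) search — moment lemma, collinearity criterion and the class data of the record cells B and D (part 2 of `UniversalDigit`)

Cell `pub-zeta5` (HONEST FRAMING: systematic search; no irrationality claim unless certified), ideation seat gen-2, generation 9
(REPORT-gen2-g9 §6, §8, §9).  STATEMENTS ONLY (`@[conjecture] def … : Prop`) plus the PROVED reductions of census g11's `RecordCellB`
(`12n < p < 12.5n`, `≥ −6`) and `RecordCellD` (`7n < p < 7.5n`, `≥ −12`) to one bonus digit each; part 1
(`Zeta5Search/UniversalDigit.lean`) has the universal first-digit lemma and the record cell A.  This file was split off part 1 only for the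
400-line rule (declarations verbatim, same namespace).  Nothing here bears on irrationality.
-/

open Finset

namespace Summit.KontsevichZagierPeriods.Zeta5Search.ClusterValuation

open Summit.KontsevichZagierPeriods.Zeta5Search.WedgeDictionary (pfData dOf)
open Summit.KontsevichZagierPeriods.Zeta5Search.CasoratianValuation (InPolytope shift casoratian)
open Literature.NumberTheory.Transcendental.BallRivoal (harm)

/-! ## §5 The mod-`p` MOMENT LEMMA and the COLLINEARITY CRITERION (REPORT-gen2-g9 §6; new 13:30Z)

The units `ḡ` of the DEEP classes (those of minimal class exponent `−N`) are, up to one constant, the residues of the rational function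
`R(Y) = ∏_{w ∈ 𝔽_p} (Y − w)^{classExp(w)+N−1}` over `𝔽_p`, whose degree is `(N−1)p − 2d − 5`; the residue theorem over `𝔽_p` gives the
moment congruences `Σ_{x deep} h(x) ḡ_x ≡ 0` for `deg h ≤ 2d+3−(N−1)p`, and the shift `b ↦ b + e_j` multiplies `R` by
`π_j(Y) = (Y − b_j)(Y − (b₀ − b_j))`.  Consequence (criterion): when the orbit digit-vectors of the deep classes are collinear in `𝔽_p²`, the
first digit of `B_j = 𝒦(b⁺)V(b) − 𝒦(b)V(b⁺)` vanishes.  LB♯♯ (`LemmaDBonus`, G8 file) is the "line through the origin" case; the record cell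
`12n < p < 12.5n` (census `RecordCellB`) is the first genuinely affine case. -/

/-- The deep classes at depth `N`: residues `x < p` whose class exponent is `−N`. -/
def deepClasses (b : ℕ → ℤ) (p N : ℕ) : Finset ℕ := (range p).filter fun x => classExp b p x = -(N : ℤ)

/-- `r ≡ 0 (mod p)` for a (`p`-integral) rational `r` (Boolean test; used as `pCong p r = true`). -/
def pCong (p : ℕ) (r : ℚ) : Bool := decide (r = 0 ∨ 1 ≤ padicValRat p r)

/-- **MOMENT LEMMA (mod `p`), PROVED on paper** (REPORT-gen2-g9 §6.1 (a)–(c): `ĝ_x ≡ 2·Res_{Y=x} R(Y)`, `deg R = (N−1)p − 2d − 5`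
(uses `0 ≤ 2b_i ≤ b₀` and the odd centre), residue theorem for `Y^i R(Y)` over `𝔽_p`, Wilson; exact check: 2,311 moment sums inside the degree
bound on 1,047 random `(b,p)`, all `≡ 0`; 4,834 of 5,976 beyond the bound are nonzero).  `−N` need only be a lower bound (if it is not attained
the sum is empty). -/
@[conjecture] def GHatMoments : Prop :=
  ∀ (b : ℕ → ℤ) (p N i : ℕ), InPolytope b → p.Prime → 5 ≤ p → 1 ≤ N →
    (∀ x, x < p → -(N : ℤ) ≤ classExp b p x) →
    ((N : ℤ) - 1) * p + i ≤ 2 * dOf b + 3 →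
      pCong p (∑ x ∈ deepClasses b p N, (x : ℚ) ^ i * gHat b p x) = true

/-- **SHIFT RULE mod `p` for every deep class** (REPORT §6.1 (d); G3 = `GHatShift` is the exact version off the moved points): with
`π_j(x) = (b_j − x)(b₀ − b_j − x)`, `ĝ_x(b + e_j) ≡ π_j(x) ĝ_x(b)` whenever `x` stays deep, and a deep class through a moved point is no longer
deep (`π_j(x) ≡ 0`).  Stated as: the depth-`N` moment sums of `b + e_j` are the `π_j`-weighted moment sums of `b`. -/
@[conjecture] def GHatShiftMoments : Prop :=
  ∀ (b : ℕ → ℤ) (p j N i : ℕ), InPolytope b → InPolytope (shift b j) → 1 ≤ j → j ≤ 7 → p.Prime → 5 ≤ p → 1 ≤ N →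
    (∀ x, x < p → -(N : ℤ) ≤ classExp b p x) →
      pCong p ((∑ x ∈ deepClasses (shift b j) p N, (x : ℚ) ^ i * gHat (shift b j) p x)
        - ∑ x ∈ deepClasses b p N, (x : ℚ) ^ i * (((b j : ℚ) - x) * (((b 0 - b j : ℤ) : ℚ) - x)) * gHat b p x) = true

/-- `σ_K(x) = [x multipole]·ĉ_x` (single-pole classes carry no `𝒦`-digit at order `3+m`). -/
noncomputable def sigmaK (b : ℕ → ℤ) (p x : ℕ) : ℚ := if 2 ≤ classPoleCount b p x then cHat b p x else 0

/-- Orbit digit-vector, `𝒦`-component: `P_K(x) = σ_K(x) + (−1)^{N+1} σ_K(x̄)` (`x̄ = conjClass b p x`), `2σ_K(x)` for a self-conjugate class. -/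
noncomputable def orbitK (b : ℕ → ℤ) (p N x : ℕ) : ℚ :=
  if CentreIn b p x then 2 * sigmaK b p x else sigmaK b p x + (-1 : ℚ) ^ (N + 1) * sigmaK b p (conjClass b p x)

/-- Orbit digit-vector, `V`-component: `P_V(x) = v̂_x + (−1)^{N+1} v̂_x̄`, `2v̂_x` for a self-conjugate class. -/
noncomputable def orbitV (b : ℕ → ℤ) (p N x : ℕ) : ℚ :=
  if CentreIn b p x then 2 * vHat b p x else vHat b p x + (-1 : ℚ) ^ (N + 1) * vHat b p (conjClass b p x)

/-- **COLLINEARITY CRITERION, PROVED on paper modulo `LeadingDigit`** (REPORT-gen2-g9 §6.2).  Regime H0: `−N` (`N ≥ 3`) bounds every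
class exponent from below and is attained by a multipole class (so `m = VB = −N`, `casLB = 3 − 2N`).  If the orbit vectors
`(P_K(x), P_V(x))`, `x` deep, all lie on one affine line `aK + cV + e ≡ 0` of `𝔽_p²` (`(a,c) ≢ (0,0)`), through the origin (`e = 0`) or with
`p` in the moment range `(N−1)p + 2 ≤ 2d + 3`, then the first Casoratian digit vanishes: `v_p(Cas_j(b)) ≥ casLB + 1`.
(`LemmaDBonus` is the through-origin case.  Exact check against the Casoratian, random `(b,p,j)`, `b₀ ≤ 40`: criterion met 2,496 times ⇒ bonus
2,496/2,496; not met in H0: 641 sharp, 7 accidental bonuses at `p ≤ 23`.) -/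
@[conjecture] def CollinearityCriterion : Prop :=
  ∀ (b : ℕ → ℤ) (p j N : ℕ), InPolytope b → InPolytope (shift b j) → 1 ≤ j → j ≤ 7 → p.Prime → 5 ≤ p → (p : ℤ) ≤ b 0 →
    (p : ℤ) ≤ dOf b → (b 0 + 2 : ℤ) < (p : ℤ) ^ 2 → 3 ≤ N →
    (∀ x, x < p → -(N : ℤ) ≤ classExp b p x) →
    (∃ x ∈ multipoleClasses b p, classExp b p x = -(N : ℤ)) →
    (∃ a c e : ℤ, ¬ ((p : ℤ) ∣ a ∧ (p : ℤ) ∣ c) ∧ (e = 0 ∨ ((N : ℤ) - 1) * p + 2 ≤ 2 * dOf b + 3) ∧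
      ∀ x ∈ deepClasses b p N, pCong p (a * orbitK b p N x + c * orbitV b p N x + e) = true) →
    casoratian b j ≠ 0 → casLB b p + 1 ≤ padicValRat p (casoratian b j)

/-- **COLLINEARITY CRITERION beyond H0 (regimes T and H0 at once), PROVED on paper modulo `LeadingDigit`** (REPORT-gen2-g9 §9.1).
The global-minimum hypothesis of `CollinearityCriterion` is weakened to: every class strictly deeper than `−N` is a TAME single-pole class
(so `VB = m = −N` is still the multipole minimum and `casLB = 3 − 2N`; the deeper classes have `v(V_y) ≥ 0`, `v(𝒦_y) ≥ 1` and do not reach the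
critical order).  Through the origin nothing else is needed; on an affine line the two level-`−N` moment sums `Σ ḡ_x` and `Σ π_j(x) ḡ_x` must
vanish — in regime H0 that is `GHatMoments`/`GHatShiftMoments`, in regime T they are given by the residue theorem with double poles at the
deeper classes (REPORT §9.1 (M′)) and usually do not vanish.  Exact check (`g9/tamedeep_check.py`, seeds 2–5, `b₀ ≤ 36`): regime T through-origin
⇒ bonus 550/550; affine with non-zero moments: 25 sharp, 1 bonus; no line: 95 sharp, 4 bonuses. -/
@[conjecture] def CollinearityCriterionT : Prop :=
  ∀ (b : ℕ → ℤ) (p j N : ℕ), InPolytope b → InPolytope (shift b j) → 1 ≤ j → j ≤ 7 → p.Prime → 5 ≤ p → (p : ℤ) ≤ b 0 →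
    (p : ℤ) ≤ dOf b → (b 0 + 2 : ℤ) < (p : ℤ) ^ 2 → 3 ≤ N →
    (∀ x, x < p → classExp b p x < -(N : ℤ) → classPoleCount b p x = 1 ∧ tameSingle b p x = true) →
    (∃ x ∈ multipoleClasses b p, classExp b p x = -(N : ℤ)) →
    (∃ a c e : ℤ, ¬ ((p : ℤ) ∣ a ∧ (p : ℤ) ∣ c) ∧
      (e = 0 ∨ (pCong p (∑ x ∈ deepClasses b p N, gHat b p x) = true ∧
                pCong p (∑ x ∈ deepClasses b p N, ((b j : ℚ) - x) * ((b 0 - b j : ℚ) - x) * gHat b p x) = true)) ∧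
      ∀ x ∈ deepClasses b p N, pCong p (a * orbitK b p N x + c * orbitV b p N x + e) = true) →
    casoratian b j ≠ 0 → casLB b p + 1 ≤ padicValRat p (casoratian b j)

/-- **FIRST-DIGIT PRODUCT FORMULA in regime `VB < m`** (REPORT-gen2-g9 §9.2; PROVED on paper modulo `LeadingDigit`): when the non-tame single-pole
minimum `VB` lies strictly below the multipole minimum `m ≤ −3`, the `𝒦`-digit carriers (multipole classes at level `m`) and the `V`-digit
carriers (non-tame single-pole classes at level `VB`) are disjoint and the `p^{3+m+VB}`-digit of `B_j` is `S_K⁺·S_V − S_K·S_V⁺`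
(`S_K = Σ ĉ_x ḡ_x`, `S_V = Σ v̂_y ḡ_y`, `⁺` = weighted by `π_j`).  Recorded here in its most useful special case, the analogue of COROLLARY P(a):
if `VB` is even and no `V`-carrier is self-conjugate (the carriers then come in conjugate pairs of one palindromic type up to reversal with
`ḡ_ȳ = −ḡ_y`, so `S_V ≡ S_V⁺ ≡ 0`), the first digit vanishes.  [Evidence: `FamilyCellB` at `t = 5` (`(0,−6,0)` carriers, `VB = −6`): 11/11;
random regime-`VB<m` instances: digit formula = actual 86/86 (15 bonus, 71 sharp).] -/
@[conjecture] def PalindromicVCarrierBonus : Prop :=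
  ∀ (b : ℕ → ℤ) (p j N M : ℕ), InPolytope b → InPolytope (shift b j) → 1 ≤ j → j ≤ 7 → p.Prime → 5 ≤ p → (p : ℤ) ≤ b 0 →
    (p : ℤ) ≤ dOf b → (b 0 + 2 : ℤ) < (p : ℤ) ^ 2 → 3 ≤ M → M < N → Even N →
    (∃ x ∈ multipoleClasses b p, classExp b p x = -(M : ℤ)) → (∀ x ∈ multipoleClasses b p, -(M : ℤ) ≤ classExp b p x) →
    (∃ y, y < p ∧ classPoleCount b p y = 1 ∧ classNu b p y = -(N : ℤ)) →
    (∀ y, y < p → classPoleCount b p y = 1 → -(N : ℤ) ≤ classNu b p y) →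
    (∀ y, y < p → classPoleCount b p y = 1 → classNu b p y = -(N : ℤ) →
        ¬ CentreIn b p y ∧ (∀ s ∈ classSet b p y, netExp b s = netExp b ((b 0).toNat - ((b 0).toNat - y) % p - (s - y)))) →
    casoratian b j ≠ 0 → casLB b p + 1 ≤ padicValRat p (casoratian b j)

/-! ### The record cell `12n < p < 12.5n` (census `RecordCellB`; REPORT-gen2-g9 §6.4 with `t = 11`) -/

/-- **CLASS-STRUCTURE LEMMA of cell B**, PROVED on paper for all `n ≥ 2` (REPORT §6.4 (B1)–(B4); integer check on all odd `p` of the cell for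
`t = 6..40, n ≤ 60` and `t = 11, n ≤ 150`, 0 violations; `decide`d below at `(n,p) = (3,37)`): `casLB = −7`; every class exponent is `≥ −5`,
`12n` is a multipole class of exponent `−5`; the moment range `4p + 2 ≤ 2d + 3` holds; every deep class is a bare three-point class, not
self-conjugate, with exponent vector `(−1,−5,1)`, `(1,−5,−1)` (multipole) or `(0,−6,1)`, `(1,−6,0)` (single pole; the first non-tame). -/
@[conjecture] def RecordCellBClassData : Prop :=
  ∀ n p : ℕ, 2 ≤ n → p.Prime → 24 * n < 2 * p → 2 * p < 25 * n →
    casLB (bRec n) p = -7 ∧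
    (∀ x, x < p → (-5 : ℤ) ≤ classExp (bRec n) p x) ∧
    (12 * n ∈ multipoleClasses (bRec n) p ∧ classExp (bRec n) p (12 * n) = -5) ∧
    4 * (p : ℤ) + 2 ≤ 2 * dOf (bRec n) + 3 ∧
    (∀ x, x < p → classExp (bRec n) p x = -5 →
      ¬ CentreIn (bRec n) p x ∧ classSet (bRec n) p x = {x, x + p, x + 2 * p} ∧
      ((netExp (bRec n) x = -1 ∧ netExp (bRec n) (x + p) = -5 ∧ netExp (bRec n) (x + 2 * p) = 1) ∨
       (netExp (bRec n) x = 1 ∧ netExp (bRec n) (x + p) = -5 ∧ netExp (bRec n) (x + 2 * p) = -1) ∨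
       (netExp (bRec n) x = 0 ∧ netExp (bRec n) (x + p) = -6 ∧ netExp (bRec n) (x + 2 * p) = 1) ∨
       (netExp (bRec n) x = 1 ∧ netExp (bRec n) (x + p) = -6 ∧ netExp (bRec n) (x + 2 * p) = 0)))

/-- Kernel check of the cell-B class data at `(n,p) = (3,37)` (`b = 3·(41;17,…,11) = (123;51,…,33)`): `casLB = −7`. -/
example : casLB (bRec 3) 37 = -7 := by
  set_option maxRecDepth 40000 in decide

/-- … and the four deep types at `(3,37)`: `x = 36 = 12n` is `(−1,−5,1)`, its conjugate `13` is `(1,−5,−1)`, `33 = 11n` is the non-tame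
single class `(0,−6,1)` and its conjugate `16` is the tame `(1,−6,0)` (REPORT §6.4: M `= [12n,p)`, M̄ `= (5n−3r,5n−2r]`, S `= [11n,12n−r]`,
S̄ `= [5n−r,6n−2r]` with `r = p − 12n = 1`). -/
example : classExp (bRec 3) 37 36 = -5 ∧ netExp (bRec 3) 36 = -1 ∧ netExp (bRec 3) 73 = -5 ∧ netExp (bRec 3) 110 = 1 ∧
    classExp (bRec 3) 37 13 = -5 ∧ netExp (bRec 3) 13 = 1 ∧ netExp (bRec 3) 50 = -5 ∧ netExp (bRec 3) 87 = -1 ∧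
    classExp (bRec 3) 37 33 = -5 ∧ netExp (bRec 3) 33 = 0 ∧ netExp (bRec 3) 70 = -6 ∧ netExp (bRec 3) 107 = 1 ∧
    classExp (bRec 3) 37 16 = -5 ∧ netExp (bRec 3) 16 = 1 ∧ netExp (bRec 3) 53 = -6 ∧ netExp (bRec 3) 90 = 0 := by
  set_option maxRecDepth 40000 in decide

/-- **The first-digit bonus on cell B** (conclusion of `CollinearityCriterion` at `b = bRec n`, `j = 7`, `12n < p < 12.5n`: the deep orbits have
the two digit vectors `(4, −7)` (multipole pairs) and `(0, 2)` (single-pole pairs) — two points are collinear —, and `4p ≤ 2d + 1`; PROVED on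
paper modulo `LeadingDigit`, REPORT-gen2-g9 §6.4; exact: `v_7 = −6 = casLB + 1` at all 7 record primes with `n ≤ 12`). -/
@[conjecture] def RecordCellBBonus : Prop :=
  ∀ n p : ℕ, 2 ≤ n → p.Prime → 24 * n < 2 * p → 2 * p < 25 * n → casoratian (bRec n) 7 ≠ 0 →
    casLB (bRec n) p + 1 ≤ padicValRat p (casoratian (bRec n) 7)

/-- Reduction statement: census g11's `RecordCellB` (`−6 ≤ v_p(Cas₇(bRec n))` on `24n < 2p < 25n`) from the bonus and `casLB = −7`. -/
def recordCellB_of_bonus_stmt : Prop :=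
  RecordCellBBonus → (∀ n p : ℕ, 2 ≤ n → p.Prime → 24 * n < 2 * p → 2 * p < 25 * n → casLB (bRec n) p = -7) →
    ∀ n p : ℕ, 2 ≤ n → p.Prime → 24 * n < 2 * p → 2 * p < 25 * n → casoratian (bRec n) 7 ≠ 0 →
      (-6 : ℤ) ≤ padicValRat p (casoratian (bRec n) 7)

/-- PROOF of `recordCellB_of_bonus_stmt` (arithmetic). -/
theorem recordCellB_of_bonus_holds : recordCellB_of_bonus_stmt := by
  intro hB hLB n p hn hp h1 h2 hc
  have := hB n p hn hp h1 h2 hc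
  rw [hLB n p hn hp h1 h2] at this
  linarith

/-! ## §6. Cell D (`7n < p < 7.5n`, census `RecordCellD` / `FamilyCellD` at `t = 11`) — an LB♯♯ instance two levels deeper than cell A

ALL-`n` CERTIFICATE (REPORT-gen2-g9 §8): the class-structure lemmas of cells A, B, D are decided for every `n` at once by exhaustive
enumeration of the faces of the line arrangement `{u₀ + kθ = c}` in the `(u₀, θ) = (x/n, p/n)` strip (`g9/facecert.py`, exact rational
arithmetic; cell A certified for `t = 4..45`, B for `t = 6..45`, D for `t = 10..45`, and the face-type sets are `t`-independent from `t = 14` on). -/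

/-- **CLASS-STRUCTURE LEMMA of cell D**, certified for all `n ≥ 2` (REPORT §8; `g9/facecert.py D 11`, claims D1–D6, D5w; `decide`d below at
`(n,p) = (4,29)`): `casLB = −13`; every class exponent is `≥ −8` and every single-pole class has `ν ≥ −7` (hypothesis (H1) of LB♯♯ with
`m = −8`); `x = 27n − 3p` (the class of the order-3 point `27n`) is a multipole class of exponent `−8`; every deep class (`E = −8`) is multipole,
not self-conjugate, misses the moved points `11n`, `30n` of `e₇`, and has exponent vector `(1,−1,−6,−3,1)`, `(1,−3,−6,−1,1)` (one type up to
reversal) or a palindrome (`(1,−2,−6,−2,1)`, `(1,1,−6,−6,1,1)`: dropped pairs, COROLLARY P(a)) — hypothesis (H2). -/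
@[conjecture] def RecordCellDClassData : Prop :=
  ∀ n p : ℕ, 2 ≤ n → p.Prime → 14 * n < 2 * p → 2 * p < 15 * n →
    casLB (bRec n) p = -13 ∧
    (∀ x, x < p → (-8 : ℤ) ≤ classExp (bRec n) p x) ∧
    (∀ x, x < p → classPoleCount (bRec n) p x = 1 → (-7 : ℤ) ≤ classNu (bRec n) p x) ∧
    (27 * n - 3 * p ∈ multipoleClasses (bRec n) p ∧ classExp (bRec n) p (27 * n - 3 * p) = -8) ∧
    (∀ x, x < p → classExp (bRec n) p x = -8 →
      ¬ CentreIn (bRec n) p x ∧ x ∈ multipoleClasses (bRec n) p ∧ 11 * n ∉ classSet (bRec n) p x ∧ 30 * n ∉ classSet (bRec n) p x ∧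
      ((classSet (bRec n) p x = {x, x + p, x + 2 * p, x + 3 * p, x + 4 * p} ∧
        ((netExp (bRec n) x = 1 ∧ netExp (bRec n) (x + p) = -1 ∧ netExp (bRec n) (x + 2 * p) = -6 ∧
            netExp (bRec n) (x + 3 * p) = -3 ∧ netExp (bRec n) (x + 4 * p) = 1) ∨
         (netExp (bRec n) x = 1 ∧ netExp (bRec n) (x + p) = -3 ∧ netExp (bRec n) (x + 2 * p) = -6 ∧
            netExp (bRec n) (x + 3 * p) = -1 ∧ netExp (bRec n) (x + 4 * p) = 1) ∨
         (netExp (bRec n) x = 1 ∧ netExp (bRec n) (x + p) = -2 ∧ netExp (bRec n) (x + 2 * p) = -6 ∧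
            netExp (bRec n) (x + 3 * p) = -2 ∧ netExp (bRec n) (x + 4 * p) = 1))) ∨
       (classSet (bRec n) p x = {x, x + p, x + 2 * p, x + 3 * p, x + 4 * p, x + 5 * p} ∧
         netExp (bRec n) x = 1 ∧ netExp (bRec n) (x + p) = 1 ∧ netExp (bRec n) (x + 2 * p) = -6 ∧
         netExp (bRec n) (x + 3 * p) = -6 ∧ netExp (bRec n) (x + 4 * p) = 1 ∧ netExp (bRec n) (x + 5 * p) = 1)))

/-- Kernel check of the cell-D class data at `(n,p) = (4,29)` (`b = 4·(41;17,…,11) = (164;68,…,44)`): `casLB = −13`. -/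
example : casLB (bRec 4) 29 = -13 := by
  set_option maxRecDepth 60000 in decide

/-- … and the deep witness at `(4,29)`: `x = 27n − 3p = 21` has points `21, 50, 79, 108, 137` (`u = 5¼, 12½, 19¾, 27, 34¼`) with exponents
`(1,−1,−6,−3,1)`, `E = −8`; its conjugate `164 − 137 = 27` is `(1,−3,−6,−1,1)`. -/
example : classExp (bRec 4) 29 21 = -8 ∧ netExp (bRec 4) 21 = 1 ∧ netExp (bRec 4) 50 = -1 ∧ netExp (bRec 4) 79 = -6 ∧
    netExp (bRec 4) 108 = -3 ∧ netExp (bRec 4) 137 = 1 ∧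
    classExp (bRec 4) 29 27 = -8 ∧ netExp (bRec 4) 27 = 1 ∧ netExp (bRec 4) 56 = -3 ∧ netExp (bRec 4) 85 = -6 ∧
    netExp (bRec 4) 114 = -1 ∧ netExp (bRec 4) 143 = 1 := by
  set_option maxRecDepth 60000 in decide

/-- **The LB♯♯ bonus on cell D** (conclusion of `LemmaDBonus` at `b = bRec n`, `j = 7`, `7n < p < 7.5n`, `m = −8`: PROVED on paper modulo
`LeadingDigit` from `RecordCellDClassData`, REPORT-gen2-g9 §8; exact: `v_7 = −12 = casLB + 1` at all 7 record primes with `n ≤ 10`). -/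
@[conjecture] def RecordCellDBonus : Prop :=
  ∀ n p : ℕ, 2 ≤ n → p.Prime → 14 * n < 2 * p → 2 * p < 15 * n → casoratian (bRec n) 7 ≠ 0 →
    casLB (bRec n) p + 1 ≤ padicValRat p (casoratian (bRec n) 7)

/-- Reduction statement: census g11's `RecordCellD` (`−12 ≤ v_p(Cas₇(bRec n))` on `14n < 2p < 15n`) from the bonus and `casLB = −13`. -/
def recordCellD_of_bonus_stmt : Prop :=
  RecordCellDBonus → (∀ n p : ℕ, 2 ≤ n → p.Prime → 14 * n < 2 * p → 2 * p < 15 * n → casLB (bRec n) p = -13) →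
    ∀ n p : ℕ, 2 ≤ n → p.Prime → 14 * n < 2 * p → 2 * p < 15 * n → casoratian (bRec n) 7 ≠ 0 →
      (-12 : ℤ) ≤ padicValRat p (casoratian (bRec n) 7)

/-- PROOF of `recordCellD_of_bonus_stmt` (arithmetic). -/
theorem recordCellD_of_bonus_holds : recordCellD_of_bonus_stmt := by
  intro hB hLB n p hn hp h1 h2 hc
  have := hB n p hn hp h1 h2 hc
  rw [hLB n p hn hp h1 h2] at this
  linarith

/-! ### Appended 2026-08-20 (gen-2 g9 `G9UniversalDigit` v6, part 2 sha256 7f665b8c…): the double-drop bonus (REPORT-gen2-g9 §10) -/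

/-- **DOUBLE-DROP BONUS ("zero" cells), PROVED on paper modulo `LeadingDigit`** (REPORT-gen2-g9 §10).  Regimes H0/T with `N = −m ≥ 3`
EVEN: if every class at level `−N` is either a tame single-pole class or centre-free with a PALINDROMIC exponent vector, then every conjugation
orbit contributes `0` to BOTH leading digits — `ĉ_T = 0` for a palindromic type with even exponent (`CHatReversal`), and the `V`-digits of a
centre-free pair cancel (`ḡ_x̄ = (−1)^{N+1} ḡ_x = −ḡ_x`, G2) — for `b` and for `b + e_j` alike (whose level-`−N` orbits are the non-hit ones of `b`,
G3); hence `v(𝒦) ≥ 4 − N`, `v(V) ≥ 1 − N` on both sides and `v_p(B_j) ≥ casLB + 2`.  Record-ray cells `(4.1n, 4.25n)`, `(6n, 6⅓n]`, `(8.2n, 8.5n]`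
(bounds `−23`, `−15`, `−11`); exact instances `(2,17)`, `(8,67)` sharp, `(5,31)`, `(6,37)` one above (`g9/rayatlas_record.md`). -/
@[conjecture] def DoubleDropBonus : Prop :=
  ∀ (b : ℕ → ℤ) (p j N : ℕ), InPolytope b → InPolytope (shift b j) → 1 ≤ j → j ≤ 7 → p.Prime → 5 ≤ p → (p : ℤ) ≤ b 0 →
    (p : ℤ) ≤ dOf b → (b 0 + 2 : ℤ) < (p : ℤ) ^ 2 → 3 ≤ N → Even N →
    (∀ x, x < p → classExp b p x < -(N : ℤ) → classPoleCount b p x = 1 ∧ tameSingle b p x = true) →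
    (∃ x ∈ multipoleClasses b p, classExp b p x = -(N : ℤ)) →
    (∀ x ∈ deepClasses b p N, (classPoleCount b p x = 1 ∧ tameSingle b p x = true) ∨
        (¬ CentreIn b p x ∧ (∀ s ∈ classSet b p x, netExp b s = netExp b ((b 0).toNat - ((b 0).toNat - x) % p - (s - x))))) →
    casoratian b j ≠ 0 → casLB b p + 2 ≤ padicValRat p (casoratian b j)

end Summit.KontsevichZagierPeriods.Zeta5Search.ClusterValuation
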